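import Literature.AlgebraicGeometry.Motives.HodgeLieWeightOnePlusLineCasimir
import Literature.RepresentationTheory.GeneralLinear.SL2TriplePairCommutant
import HarnessLib

/-!
# Weight one, type-III position, `Lie Hg` `ℚ`-simple of dimension `6`: `dim_ℚ End_Hdg = (dim_ℚ V / 4)²` with centre `ℚ`

Family `hodge`, layer `Literature/AlgebraicGeometry/Motives`; THEOREMS ONLY (no definition, no named fact; D-0026).
Sequel of `HodgeLieWeightOnePlusLineCasimir` for the cell `pub-hodgecm2` (COR-CM) lane MT-RANK-SEVEN-TYPEIII, seat `b27`.

SETTING (type III): `H` polarizable of weight `1` on `V` (`d = dim_ℚ V`), graded basis `e`, Hodge projector `P`, plus-line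
hypotheses (`E F = αP`, `F E = α(1 − P)`), `𝔷 = 0`, `Lie Hg` simple of dimension `6`, and `(h′, e′, f′)` the `sl₂`-triple
spanning `𝔨` in STANDARD FORM (`h′² = 1`, `e′f′ = ½(1 + h′)`, …; `HodgeLieWeightOnePlusLineCasimir.standardForm_of_plusLine`),
so that with `P′ = ½(1 + h′)` the triples `(P, E, F; α)` and `(P′, e′, f′; 1)` are two commuting `sl₂`-triples in isotypic
position on `V_ℂ ≅ W₁₁ ⊗ std ⊗ std′`.

* **`mem_spanC_endAlg_iff_commute_pair`** — `𝒞 = End_Hdg ⊗ ℂ` is the joint commutant of `P, E, F, P′, e′, f′`.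
* **`four_mul_finrank_range_eq`** — `4 · rk(P′P) = d` (`tr(P′P) = ½ tr P = d/4`, since `tr(h′P) = tr([e′, f′]P) = 0`).
* **`finrank_endAlg_of_plusLine`** — `∃ k, d = 4k ∧ dim_ℚ End_Hdg(V) = k²` and every central Hodge endomorphism is a
  rational scalar (`SL2TriplePairCommutant`: `dim 𝒞 = (rk P′P)²`, scalar centre; `dim_ℂ 𝒞 = dim_ℚ End_Hdg`).

## References

* [MoonenZarhin1999LowDim] B. Moonen, Yu. Zarhin, *Hodge classes on abelian varieties of low dimension*, Math. Ann. 315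
  (1999), §2 (2.3) Type III.
* [FultonHarris1991] W. Fulton, J. Harris, GTM 129 (1991), Lecture 11 (§11.1), §6.1.
* [Deligne1982HodgeCycles] P. Deligne, LNM 900 (1982), I §3 (3.4–3.6).
-/

noncomputable section

open scoped TensorProduct

namespace Literature.AlgebraicGeometry.Motives

universe u

namespace HodgeStructure

open ProjectorBlocks Literature.RepresentationTheory.GeneralLinear

variable {V : Type u} [AddCommGroup V] [Module ℚ V] [Module.Finite ℚ V] [HodgeTensorFacts.{u, u}] {n : ℤ}
  {S : Type u} [Fintype S] [DecidableEq S] {deg : S → ℤ}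

/-! ## §1 `𝒞 = End_Hdg ⊗ ℂ` is the joint commutant of the two triples -/

/-- **`End_Hdg ⊗ ℂ = span_ℂ {a_ℂ}` is the joint commutant of `P, E, F` and `P′ = ½(1 + h′), e′, f′`** for an `sl₂`-triple
`(h′, e′, f′)` spanning `𝔨` (type-III position): `⊆` since Hodge endomorphisms commute with `𝔥_ℂ ∋ E, F, 2P − 1, h′, e′, f′`
(`commute_baseChange_of_mem_hodgeLieC`); `⊇` since `𝔥_ℂ = ℂE ⊕ ℂF ⊕ ℂΘ ⊕ 𝔨` (`exists_decomposition_of_plusLine`) and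
`mem_span_endAlg_of_forall_commute`. [cite: MoonenZarhin1999LowDim, §2 (2.3)] [cite: Deligne1982HodgeCycles, I §3 (3.4–3.6)] -/
theorem mem_spanC_endAlg_iff_commute_pair (H : HodgeStructure V n) (hn : n = 1)
    (e : Module.Basis S ℂ (ℂ ⊗[ℚ] V)) (hF : ∀ a, H.F a = Submodule.span ℂ (e '' {σ | a ≤ deg σ}))
    (hFc : ∀ a, complexConj (H.F a) = Submodule.span ℂ (e '' {σ | deg σ ≤ n - a}))
    (hdeg : ∀ σ, deg σ = 0 ∨ deg σ = 1) {X : Module.End ℚ V} (hX : X ∈ H.hodgeLie)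
    (hplus : ∀ Y ∈ H.hodgeLieC, ∃ c : ℂ,
      gradingEnd e deg * Y * (1 - gradingEnd e deg) = c • (gradingEnd e deg * X.baseChange ℂ * (1 - gradingEnd e deg)))
    (hminus : ∀ Y ∈ H.hodgeLieC, ∃ c : ℂ,
      (1 - gradingEnd e deg) * Y * gradingEnd e deg = c • ((1 - gradingEnd e deg) * X.baseChange ℂ * gradingEnd e deg))
    {h' e' f' : Module.End ℂ (ℂ ⊗[ℚ] V)} (hhM : h' ∈ H.hodgeLieC) (heM : e' ∈ H.hodgeLieC) (hfM : f' ∈ H.hodgeLieC)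
    (hspan : ∀ K ∈ H.hodgeLieC, K * gradingEnd e deg = gradingEnd e deg * K →
      K * (gradingEnd e deg * X.baseChange ℂ * (1 - gradingEnd e deg)) =
        (gradingEnd e deg * X.baseChange ℂ * (1 - gradingEnd e deg)) * K →
      ∃ a b c : ℂ, K = a • h' + b • e' + c • f') (T : Module.End ℂ (ℂ ⊗[ℚ] V)) :
    T ∈ Submodule.span ℂ ((fun c : Module.End ℚ V => c.baseChange ℂ) '' (H.endAlg : Set (Module.End ℚ V))) ↔
      (T * gradingEnd e deg = gradingEnd e deg * T ∧
        T * (gradingEnd e deg * X.baseChange ℂ * (1 - gradingEnd e deg)) =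
          (gradingEnd e deg * X.baseChange ℂ * (1 - gradingEnd e deg)) * T ∧
        T * ((1 - gradingEnd e deg) * X.baseChange ℂ * gradingEnd e deg) =
          ((1 - gradingEnd e deg) * X.baseChange ℂ * gradingEnd e deg) * T) ∧
      (T * ((2 : ℂ)⁻¹ • (1 + h')) = ((2 : ℂ)⁻¹ • (1 + h')) * T ∧ T * e' = e' * T ∧ T * f' = f' * T) := by
  classical
  obtain ⟨hEM, hFM⟩ := projE_mem_hodgeLieC H e hF hFc hdeg (H.baseChange_mem_hodgeLieC hX)
  have hΘM : (2 : ℂ) • gradingEnd e deg - 1 ∈ H.hodgeLieC := by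
    have h := two_smul_gradingEnd_sub_mem_hodgeLieC H e hF hFc
    have h1 : ((n : ℤ) : ℂ) • (1 : Module.End ℂ (ℂ ⊗[ℚ] V)) = 1 := by rw [hn, Int.cast_one, one_smul]
    rw [h1] at h
    exact h
  -- commuting with `Θ = 2P − 1` versus `P`, with `P′ = ½(1 + h′)` versus `h′`
  have hΘiff : ∀ T : Module.End ℂ (ℂ ⊗[ℚ] V), T * ((2 : ℂ) • gradingEnd e deg - 1) = ((2 : ℂ) • gradingEnd e deg - 1) * T ↔
      T * gradingEnd e deg = gradingEnd e deg * T := by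
    intro T
    rw [mul_sub, sub_mul, mul_one, one_mul, sub_left_inj, mul_smul_comm, smul_mul_assoc]
    exact (smul_right_injective _ (two_ne_zero (α := ℂ))).eq_iff
  have hP'iff : ∀ T : Module.End ℂ (ℂ ⊗[ℚ] V), T * ((2 : ℂ)⁻¹ • (1 + h')) = ((2 : ℂ)⁻¹ • (1 + h')) * T ↔
      T * h' = h' * T := by
    intro T
    rw [mul_smul_comm, smul_mul_assoc, (smul_right_injective _ (inv_ne_zero (two_ne_zero (α := ℂ)))).eq_iff, mul_add,
      add_mul, mul_one, one_mul, add_right_inj]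
  constructor
  · intro hT
    induction hT using Submodule.span_induction with
    | mem Z hZ =>
      obtain ⟨a, ha, rfl⟩ := hZ
      have hc : ∀ {Y}, Y ∈ H.hodgeLieC → a.baseChange ℂ * Y = Y * a.baseChange ℂ := fun hY =>
        (commute_baseChange_of_mem_hodgeLieC H hY ⟨a, ha⟩).symm
      exact ⟨⟨(hΘiff _).1 (hc hΘM), hc hEM, hc hFM⟩, (hP'iff _).2 (hc hhM), hc heM, hc hfM⟩
    | zero => exact ⟨⟨by rw [zero_mul, mul_zero], by rw [zero_mul, mul_zero], by rw [zero_mul, mul_zero]⟩,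
        by rw [zero_mul, mul_zero], by rw [zero_mul, mul_zero], by rw [zero_mul, mul_zero]⟩
    | add T₁ T₂ _ _ h₁ h₂ =>
      obtain ⟨⟨a1, a2, a3⟩, a4, a5, a6⟩ := h₁
      obtain ⟨⟨b1, b2, b3⟩, b4, b5, b6⟩ := h₂
      exact ⟨⟨by rw [add_mul, mul_add, a1, b1], by rw [add_mul, mul_add, a2, b2], by rw [add_mul, mul_add, a3, b3]⟩,
        by rw [add_mul, mul_add, a4, b4], by rw [add_mul, mul_add, a5, b5], by rw [add_mul, mul_add, a6, b6]⟩
    | smul c T₁ _ h₁ =>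
      obtain ⟨⟨a1, a2, a3⟩, a4, a5, a6⟩ := h₁
      exact ⟨⟨by rw [smul_mul_assoc, mul_smul_comm, a1], by rw [smul_mul_assoc, mul_smul_comm, a2],
        by rw [smul_mul_assoc, mul_smul_comm, a3]⟩, by rw [smul_mul_assoc c T₁, mul_smul_comm c _ T₁, a4],
        by rw [smul_mul_assoc, mul_smul_comm, a5], by rw [smul_mul_assoc, mul_smul_comm, a6]⟩
  · rintro ⟨⟨hTP, hTE, hTF⟩, hTP', hTe, hTf⟩
    have hTh : T * h' = h' * T := (hP'iff T).1 hTP'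
    have hTΘ := (hΘiff T).2 hTP
    refine mem_span_endAlg_of_forall_commute H fun X₁ hX₁ => ?_
    obtain ⟨c, c', d, K, hKM, hKP, hKE, hdec⟩ :=
      exists_decomposition_of_plusLine H hn e hF hFc hdeg hX hplus hminus (H.baseChange_mem_hodgeLieC hX₁)
    obtain ⟨a, b, c₃, hK⟩ := hspan K hKM hKP hKE
    rw [hdec, hK]
    simp only [mul_add, add_mul, mul_smul_comm, smul_mul_assoc, hTE, hTF, hTΘ, hTh, hTe, hTf]

/-! ## §2 The rank of `P′P` -/

omit [HodgeTensorFacts.{u, u}] in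
/-- **`4 · rk(P′P) = dim_ℚ V`** for `P′ = ½(1 + h′)`, `(h′, e′, f′)` the standard `sl₂`-triple of `𝔨` (`h′ = e′f′ − f′e′`,
`h′² = 1`, commuting with `P`): `P′P` is idempotent with trace `½(tr P + tr(h′P)) = ½ · d/2`, as `tr(h′P) = tr([e′, f′]P) = 0`.
[cite: MoonenZarhin1999LowDim, §2 (2.3)] [cite: FultonHarris1991, Lecture 11 (§11.1)] -/
theorem four_mul_finrank_range_eq {P E F h' e' f' : Module.End ℂ (ℂ ⊗[ℚ] V)} {α : ℂ} (hα : α ≠ 0)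
    (hPP : P * P = P) (hEF : E * F = α • P) (hFE : F * E = α • (1 - P))
    (hhP : h' * P = P * h') (heP : e' * P = P * e') (hef : e' * f' - f' * e' = h') (hhh : h' * h' = 1) :
    4 * Module.finrank ℂ (LinearMap.range (((2 : ℂ)⁻¹ • (1 + h')) * P)) = Module.finrank ℚ V := by
  -- `P′P` is idempotent
  have hsq : (1 + h') * (1 + h') = (2 : ℂ) • (1 + h') := by
    rw [add_mul, one_mul, mul_add, mul_one, hhh, two_smul]
    abel
  have hP'sq : ((2 : ℂ)⁻¹ • (1 + h')) * ((2 : ℂ)⁻¹ • (1 + h')) = (2 : ℂ)⁻¹ • (1 + h') := by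
    rw [smul_mul_assoc, mul_smul_comm, smul_smul, hsq, smul_smul]
    norm_num
  have hcommP : P * ((2 : ℂ)⁻¹ • (1 + h')) = ((2 : ℂ)⁻¹ • (1 + h')) * P := by
    rw [mul_smul_comm, smul_mul_assoc, mul_add, add_mul, mul_one, one_mul, hhP]
  have hidem : IsIdempotentElem (((2 : ℂ)⁻¹ • (1 + h')) * P) := by
    change ((2 : ℂ)⁻¹ • (1 + h')) * P * (((2 : ℂ)⁻¹ • (1 + h')) * P) = ((2 : ℂ)⁻¹ • (1 + h')) * P
    rw [mul_assoc, ← mul_assoc P, hcommP, mul_assoc, hPP, ← mul_assoc, hP'sq]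
  have htr := (LinearMap.IsIdempotentElem.isProj_range _ hidem).trace
  -- `tr(h′P) = 0`, `2 tr P = d`
  have hhtr : LinearMap.trace ℂ (ℂ ⊗[ℚ] V) (h' * P) = 0 := by
    rw [← hef, sub_mul, map_sub, mul_assoc, mul_assoc, LinearMap.trace_mul_comm ℂ e' (f' * P), mul_assoc, ← heP, sub_self]
  have hd : 2 * LinearMap.trace ℂ (ℂ ⊗[ℚ] V) P = (Module.finrank ℚ V : ℂ) := by
    have h := (two_mul_trace_mul_proj (z := 1) hα hEF hFE (by rw [one_mul, mul_one])).1
    rw [one_mul, LinearMap.trace_one, Module.finrank_baseChange] at h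
    exact h
  have h4 : (4 : ℂ) * LinearMap.trace ℂ (ℂ ⊗[ℚ] V) (((2 : ℂ)⁻¹ • (1 + h')) * P) = (Module.finrank ℚ V : ℂ) := by
    rw [smul_mul_assoc, add_mul, one_mul, map_smul, map_add, hhtr, add_zero, smul_eq_mul, ← hd]
    ring
  rw [htr] at h4
  exact_mod_cast h4

/-! ## §3 `dim_ℚ End_Hdg = (d/4)²` and the centre -/

/-- **`dim_ℚ End_Hdg(V) = (dim_ℚ V / 4)²` and `Z(End_Hdg(V)) = ℚ`** for a weight-one polarizable Hodge structure in the
type-III position (`𝔷 = 0`, `Lie Hg` `ℚ`-simple of dimension `6`, grading `(1,1,4)`), given the standard `sl₂`-triple of `𝔨`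
(`standardForm_of_plusLine`): `V_ℂ ≅ W₁₁ ⊗ std ⊗ std′` for the two commuting standard `sl₂`'s, so `End_Hdg ⊗ ℂ ≅ End(W₁₁)`
(`SL2TriplePairCommutant`), `dim W₁₁ = d/4`. [cite: MoonenZarhin1999LowDim, §2 (2.3)] [cite: FultonHarris1991, Lecture 11 (§11.1)]
[cite: Deligne1982HodgeCycles, I §3 (3.4–3.6)] -/
theorem finrank_endAlg_of_plusLine (H : HodgeStructure V n) (ψ : H.Polarization) (hn : n = 1)
    (e : Module.Basis S ℂ (ℂ ⊗[ℚ] V)) (hF : ∀ a, H.F a = Submodule.span ℂ (e '' {σ | a ≤ deg σ}))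
    (hFc : ∀ a, complexConj (H.F a) = Submodule.span ℂ (e '' {σ | deg σ ≤ n - a}))
    (hdeg : ∀ σ, deg σ = 0 ∨ deg σ = 1) {X : Module.End ℚ V} (hX : X ∈ H.hodgeLie) (hXE : X ∉ H.endAlg)
    (hplus : ∀ Y ∈ H.hodgeLieC, ∃ c : ℂ,
      gradingEnd e deg * Y * (1 - gradingEnd e deg) = c • (gradingEnd e deg * X.baseChange ℂ * (1 - gradingEnd e deg)))
    (hminus : ∀ Y ∈ H.hodgeLieC, ∃ c : ℂ,
      (1 - gradingEnd e deg) * Y * gradingEnd e deg = c • ((1 - gradingEnd e deg) * X.baseChange ℂ * gradingEnd e deg))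
    (hz : H.hodgeLie ⊓ Subalgebra.toSubmodule H.endAlg = ⊥)
    {h' e' f' : Module.End ℂ (ℂ ⊗[ℚ] V)}
    (hh' : h' ∈ H.hodgeLieC ∧ h' * gradingEnd e deg = gradingEnd e deg * h' ∧
      h' * (gradingEnd e deg * X.baseChange ℂ * (1 - gradingEnd e deg)) =
        (gradingEnd e deg * X.baseChange ℂ * (1 - gradingEnd e deg)) * h')
    (he' : e' ∈ H.hodgeLieC ∧ e' * gradingEnd e deg = gradingEnd e deg * e' ∧
      e' * (gradingEnd e deg * X.baseChange ℂ * (1 - gradingEnd e deg)) =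
        (gradingEnd e deg * X.baseChange ℂ * (1 - gradingEnd e deg)) * e')
    (hf' : f' ∈ H.hodgeLieC ∧ f' * gradingEnd e deg = gradingEnd e deg * f' ∧
      f' * (gradingEnd e deg * X.baseChange ℂ * (1 - gradingEnd e deg)) =
        (gradingEnd e deg * X.baseChange ℂ * (1 - gradingEnd e deg)) * f')
    (hspan : ∀ K ∈ H.hodgeLieC, K * gradingEnd e deg = gradingEnd e deg * K →
      K * (gradingEnd e deg * X.baseChange ℂ * (1 - gradingEnd e deg)) =
        (gradingEnd e deg * X.baseChange ℂ * (1 - gradingEnd e deg)) * K →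
      ∃ a b c : ℂ, K = a • h' + b • e' + c • f')
    (hstd : h' * h' = 1 ∧ e' * e' = 0 ∧ f' * f' = 0 ∧ e' * f' = (2 : ℂ)⁻¹ • (1 + h') ∧ f' * e' = (2 : ℂ)⁻¹ • (1 - h') ∧
      h' * e' = e' ∧ e' * h' = -e' ∧ h' * f' = -f' ∧ f' * h' = f') :
    ∃ k : ℕ, Module.finrank ℚ V = 4 * k ∧ Module.finrank ℚ H.endAlg = k ^ 2 ∧
      ∀ a ∈ H.endAlg, (∀ b ∈ H.endAlg, b * a = a * b) → ∃ q : ℚ, a = q • 1 := by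
  classical
  obtain ⟨hhM, hhP, hhE⟩ := hh'
  obtain ⟨heM, heP, heE⟩ := he'
  obtain ⟨hfM, hfP, hfE⟩ := hf'
  obtain ⟨hhh, hee, hff, hef', hfe', hhe', heh', hhf', hfh'⟩ := hstd
  have hef : e' * f' - f' * e' = h' := by
    rw [hef', hfe']
    module
  obtain ⟨α, hα, hEF, hFE, -⟩ :=
    projE_mul_projF_eq_smul_of_plusLine_of_center_eq_bot H ψ hn e hF hFc hdeg hX hXE hplus hminus hz
  have hPP : gradingEnd e deg * gradingEnd e deg = gradingEnd e deg := gradingEnd_mul_gradingEnd_of_deg e hdeg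
  obtain ⟨hhF, -⟩ := commute_of_plusLine H ψ hn e hF hFc hdeg hX hXE hplus hminus hz hhP hhE
  obtain ⟨heF, -⟩ := commute_of_plusLine H ψ hn e hF hFc hdeg hX hXE hplus hminus hz heP heE
  obtain ⟨hfF, -⟩ := commute_of_plusLine H ψ hn e hF hFc hdeg hX hXE hplus hminus hz hfP hfE
  have h𝒟 := mem_spanC_endAlg_iff_commute_pair H hn e hF hFc hdeg hX hplus hminus hhM heM hfM hspan
  have hrk := four_mul_finrank_range_eq hα hPP hEF hFE hhP heP hef hhh
  set P := gradingEnd e deg with hP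
  set E := P * X.baseChange ℂ * (1 - P) with hEdef
  set F := (1 - P) * X.baseChange ℂ * P with hFdef
  have hPE : P * E = E := by rw [hEdef, ← mul_assoc, ← mul_assoc, hPP]
  have hEP : E * P = 0 := by
    rw [hEdef, mul_assoc (P * X.baseChange ℂ) (1 - P) P, sub_mul, one_mul, hPP, sub_self, mul_zero]
  have hPF : P * F = 0 := by
    rw [hFdef, mul_assoc (1 - P) (X.baseChange ℂ) P, ← mul_assoc P (1 - P), mul_sub, mul_one, hPP, sub_self, zero_mul]
  have hFP : F * P = F := by rw [hFdef, mul_assoc ((1 - P) * X.baseChange ℂ) P P, hPP]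
  clear_value P E F
  -- the second triple `(P′, e′, f′; 1)` in isotypic position, commuting with the first
  obtain ⟨P', hP'⟩ : ∃ P' : Module.End ℂ (ℂ ⊗[ℚ] V), P' = (2 : ℂ)⁻¹ • (1 + h') := ⟨_, rfl⟩
  have hsq : (1 + h') * (1 + h') = (2 : ℂ) • (1 + h') := by
    rw [add_mul, one_mul, mul_add, mul_one, hhh, two_smul]
    abel
  have hP'P' : P' * P' = P' := by
    rw [hP', smul_mul_assoc, mul_smul_comm, smul_smul, hsq, smul_smul]
    norm_num
  have hP'e : P' * e' = e' := by
    rw [hP', smul_mul_assoc, add_mul, one_mul, hhe', ← two_smul ℂ e', smul_smul]; norm_num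
  have heP' : e' * P' = 0 := by rw [hP', mul_smul_comm, mul_add, mul_one, heh', add_neg_cancel, smul_zero]
  have hP'f : P' * f' = 0 := by rw [hP', smul_mul_assoc, add_mul, one_mul, hhf', add_neg_cancel, smul_zero]
  have hfP' : f' * P' = f' := by
    rw [hP', mul_smul_comm, mul_add, mul_one, hfh', ← two_smul ℂ f', smul_smul]; norm_num
  have hef1 : e' * f' = (1 : ℂ) • P' := by rw [one_smul, hP', hef']
  have hfe1 : f' * e' = (1 : ℂ) • (1 - P') := by
    rw [one_smul, hP', hfe']
    module
  have hP'P : P' * P = P * P' := by rw [hP', smul_mul_assoc, mul_smul_comm, add_mul, mul_add, one_mul, mul_one, hhP]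
  have hP'E : P' * E = E * P' := by rw [hP', smul_mul_assoc, mul_smul_comm, add_mul, mul_add, one_mul, mul_one, hhE]
  have hP'F : P' * F = F * P' := by rw [hP', smul_mul_assoc, mul_smul_comm, add_mul, mul_add, one_mul, mul_one, hhF]
  rw [← hP'] at h𝒟 hrk
  -- dimension
  have hdim := SL2Triple.finrank_pairCommutant_eq_sq hα hPP hPE hEP hPF hFP hEF hFE one_ne_zero hP'P' hP'e heP' hP'f hfP'
    hef1 hfe1 hP'P hP'E hP'F heP heE heF hfP hfE hfF h𝒟
  have hfr : Module.finrank ℂ (Submodule.span ℂ ((fun c : Module.End ℚ V => c.baseChange ℂ) ''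
      (H.endAlg : Set (Module.End ℚ V)))) = Module.finrank ℚ H.endAlg := by
    rw [← Subalgebra.finrank_toSubmodule, ← finrank_span_baseChange_image (Subalgebra.toSubmodule H.endAlg)]
    rfl
  refine ⟨Module.finrank ℂ (LinearMap.range (P' * P)), hrk.symm, by rw [← hfr, hdim], fun a ha hac => ?_⟩
  -- centre
  have hd0 : Module.finrank ℚ V ≠ 0 := by
    intro h0
    haveI := Module.finrank_zero_iff.1 h0
    exact hXE (by rw [show X = 0 from LinearMap.ext fun v => Subsingleton.elim _ _]; exact zero_mem _)
  have h0 : P' * P ≠ 0 := by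
    intro h
    apply hd0
    rw [← hrk, h, LinearMap.range_zero, finrank_bot, mul_zero]
  have haC : a.baseChange ℂ ∈ Submodule.span ℂ ((fun c : Module.End ℚ V => c.baseChange ℂ) ''
      (H.endAlg : Set (Module.End ℚ V))) := Submodule.subset_span ⟨a, ha, rfl⟩
  have hacomm : ∀ T ∈ Submodule.span ℂ ((fun c : Module.End ℚ V => c.baseChange ℂ) '' (H.endAlg : Set (Module.End ℚ V))),
      a.baseChange ℂ * T = T * a.baseChange ℂ := by
    intro T hT
    induction hT using Submodule.span_induction with
    | mem Z hZ =>
      obtain ⟨b, hb, rfl⟩ := hZ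
      rw [← LinearMap.baseChange_mul, ← LinearMap.baseChange_mul, ← hac b hb]
    | zero => rw [mul_zero, zero_mul]
    | add T₁ T₂ _ _ h₁ h₂ => rw [mul_add, add_mul, h₁, h₂]
    | smul c T₁ _ h₁ => rw [mul_smul_comm, smul_mul_assoc, h₁]
  obtain ⟨c, hc⟩ := SL2Triple.exists_eq_smul_one_of_mem_center_pairCommutant hα hPP hPE hEP hPF hFP hEF hFE one_ne_zero
    hP'P' hP'e heP' hP'f hfP' hef1 hfe1 hP'P hP'E hP'F heP heE heF hfP hfE hfF h0 h𝒟 haC hacomm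
  -- descent of the scalar
  have hmem : a.baseChange ℂ ∈ spanC (Submodule.span ℚ {(1 : Module.End ℚ V)}) := by
    rw [hc, show (c • (1 : Module.End ℂ (ℂ ⊗[ℚ] V))) = c • (1 : Module.End ℚ V).baseChange ℂ by
      rw [LinearMap.baseChange_one]]
    exact Submodule.smul_mem _ c (baseChange_mem_spanC (Submodule.mem_span_singleton_self _))
  obtain ⟨q, hq⟩ := Submodule.mem_span_singleton.1 (mem_of_baseChange_mem_spanC _ hmem)
  exact ⟨q, hq.symm⟩

end HodgeStructure

end Literature.AlgebraicGeometry.Motives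

end
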